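import Summits.CriticalPhenomena.PercolationContinuityZ3.Theorems.PercNearOneGluingNoHeavyConstsMDLXJoint
import Summits.CriticalPhenomena.PercolationContinuityZ3.Theorems.PercNearOneGluingNoHeavyConstsConditionedMarker
import Literature.Probability.Percolation.TwoSetConditionalAssociation
import HarnessLib

/-!
# The marker-avoidance split of the MDL(X)′ margin: `MDLX = ν(A)·I1 + ν(Q)·I3` along `A = {y ↮ X}` (PAPER-2 track (ii), seat
# `prim-consts-2`, gen 20)

builds on p205010 (kernel theorem, internal audit signed; external expert review pending).  Support file (`--supports
stmt-CriticalPhenomena-4575`); theorems only, no sorries, standard axioms.  Memo `run/shared/lean/prim/consts/FROM-prim-consts-2-g20-AVOID-SPLIT.md`.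

Notation (as in `…ConstsMDLXJoint.lean`): owner `s`, avoided set `X`, markers `y, z`; `D = {s ↮ X}`, `A = {y ↮ X}`, `Q = Aᶜ = {y ↔ X}`,
`E₁ = D ∩ A = {{s,y} ↮ X}`, `D_Q = D ∩ Q`, `T = {y ↮ {s}∪X} ∩ D` (`= E₁ ∩ {s ↮ y}`), `W = {y ↔ z}`, `Y = {s ↔ y}`, `Z = {s ↔ z}`,
`cov_E(F;B) = μ(E)∫_{E∩B}F − (∫_E F)μ(E∩B)`.  The `Consts.MDLXJoint` margin is `M = μ(T)·cov_D(F;Z) − μ(T∩W)·cov_D(F;Y)`.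

* `Consts.mdlx_avoidSplit_identity` — **EXACT IDENTITY** (law of total covariance over the partition `D = E₁ ⊔ D_Q`; on `D_Q` the marker event
  `Y` is empty, because `s ↔ y ↔ X` contradicts `s ↮ X`):
  `μ(E₁)μ(D_Q)·M = μ(D)μ(D_Q)·M₁ + μ(T)μ(D)μ(E₁)·cov_{D_Q}(F;Z) + G·H`, where
  `M₁ = μ(T)·cov_{E₁}(F;Z) − μ(T∩W)·cov_{E₁}(F;Y)` is the MDL(X)′ margin with the conditioning `D = {s↮X}` replaced by the
  SOURCE-AND-MARKER repulsion `E₁ = {{s,y}↮X}` ("MDL(X)″": MDL(∅) for `μ(·|E₁)` with that measure's own constant `P(y↔z | s↮y)`),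
  `G = μ(T)μ(E₁∩Z)μ(D_Q) − μ(T)μ(D_Q∩Z)μ(E₁) − μ(T∩W)μ(D∩Y)μ(D_Q)` and `H = (∫_{E₁}F)μ(D_Q) − (∫_{D_Q}F)μ(E₁)`.
* `Consts.avoidSplit_transfer_nonneg` — **`H ≥ 0`** for monotone `F`: `E_ν[F | y↮X] ≥ E_ν[F | y↔X]` under `ν = μ(·|D)`; van den
  Berg–Häggström–Kahn Thm 2.1 with sets (`F(C_s)` increasing in `C_s`, `1{y ∉ V(C_X)}` decreasing in `C_X`, given `s ↮ X`).
* `Consts.mdlxJoint_of_avoidSplit` — **REDUCTION**: if `M₁ ≥ 0` (the `E₁`-form) and `μ(T)μ(D)μ(E₁)·cov_{D_Q}(F;Z) + G·H ≥ 0` (the `Q`-world form),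
  then the `Consts.MDLXJoint` inequality holds at `(w, s, y, z, X, F)`.
`G ≥ 0` (the MDL(X)′ margin at the antitone `C_X`-functional `1{y ∉ V(C_X)}`, via `Consts.mdlxJoint_jointClass_of_at` and the class
`Consts.mdlxJoint_of_lowerMarker_le`) is `Consts.mdlx_gain_nonneg` (`…ConstsMDLXJointAvoidSplitGain.lean`).  STATUS (exact, all up-sets):
**the `E₁`-form `M₁ ≥ 0` ("MDL(X)″") is FALSE** — kernel refutation `Consts.not_mdlRepelled` (`…ConstsRepelledMDLRefutation.lean`): `n = 6`, pairs
`01,02,13,15,24,25,35,45`, weights `1023/1024,31/32,1023/1024,1/2,15/16,3/4,63/64,63/64`, `s=0,y=4,z=2,X={3}`, `F = 1{s(0,1) ∈ C}`: `M₁ = −1.7·10¹⁹/2¹²⁶`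
(5 % ratio violation at corner weights; palette censuses j201432/j201436 had 0/307 520).  `M₁ = 0` EXACTLY at the marker-pair cylinder `F = 1{s(s,y) ∈ C}`
in every graph (under `μ(·|E₁)` the pair `s(s,y)` is independent of the rest) — unlike the `Consts.MDLXJoint` margin (`w(1−w)²·J2 > 0` there).  **The `Q`-world
form is NOT always `≥ 0` either**: 3 exact failures in 300 884 (e.g. `n = 6`, pairs `01,03,04,05,12,14,15,23,24,25`, weights `1/2,63/64,511/512,
1/64,1/2,127/128,1/2,1/2,63/64,1/1024`, `s=3,y=5,z=2,X={4}`, `F = 1{s(0,3) ∈ C}`: `−6.4·10⁻⁷`·μ(D)²), all with `p' < 10⁻⁴`.  Both blocks are unsigned;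
the reduction below is valid instance by instance but is not a route (`Consts.MDLXJoint`: 0 violations on the same screens; memo …-g20-AVOID-SPLIT.md).
[cite: VandenbergHaggstromKahn2005, Thm. 2.1 (p. 9) at q = 1, Remark 1 after Thm. 1.2 (p. 5); Thm. 1.3 (p. 6)]
-/

noncomputable section

namespace Summit.CriticalPhenomena.PercolationContinuityZ3.Theorems

open MeasureTheory Set Literature.Probability.LatticeModels Literature.Probability.Percolation
open scoped Classical

namespace Consts

variable {V : Type*} [Fintype V]

omit [Fintype V] in
/-- The algebra of the avoidance split (ring identity; `d = e+q`, `∫_D F = fE+fQ`, `μ(D∩Z) = zE+zQ`, `∫_{D∩Z}F = fzE+fzQ`). [folklore] -/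
theorem mdlx_avoidSplit_algebra (t tw e q fE fQ zE zQ fzE fzQ mY fY : ℝ) :
    e * q * (t * ((e + q) * (fzE + fzQ) - (fE + fQ) * (zE + zQ)) - tw * ((e + q) * fY - (fE + fQ) * mY)) =
      (e + q) * q * (t * (e * fzE - fE * zE) - tw * (e * fY - fE * mY)) +
        t * (e + q) * e * (q * fzQ - fQ * zQ) +
        (t * zE * q - t * zQ * e - tw * mY * q) * (fE * q - fQ * e) := by
  ring

omit [Fintype V] in
/-- On `D = {s ↮ X}`, the marker event `{s ↔ y}` forces `{y ↮ X}`. [folklore] -/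
theorem inter_openConn_subset_avoid (s y : V) (X : Set V) :
    ({ω : BondConfig V | ∀ x ∈ X, ¬ (openGraph ω).Reachable s x} ∩ openConn s y) ⊆
      {ω : BondConfig V | ∀ x ∈ X, ¬ (openGraph ω).Reachable y x} := by
  rintro ω ⟨hD, hY⟩ x hx hyx
  exact hD x hx ((hY : (openGraph ω).Reachable s y).trans hyx)

/-- **THE MARKER-AVOIDANCE SPLIT OF THE MDL(X)′ MARGIN (exact identity).**  For all weights, `s, y, z, X` and EVERY `F`:
`μ(E₁)μ(D_Q)·M = μ(D)μ(D_Q)·M₁ + μ(T)μ(D)μ(E₁)·cov_{D_Q}(F;Z) + G·H` with the letters of the module docstring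
(`E₁ = D ∩ {y↮X}`, `D_Q = D ∩ {y↮X}ᶜ`).  Law of total covariance of `F(C_s)` and `1_Z − p'1_Y` under `μ(·|D)` over `{y↮X}, {y↔X}`.
[cite: VandenbergHaggstromKahn2005, §2.1 (pp. 9–13)] -/
theorem mdlx_avoidSplit_identity (w : Sym2 V → unitInterval) (s y z : V) (X : Set V) (F : Set (Sym2 V) → ℝ) :
    (prodBernoulli w).real ({ω : BondConfig V | ∀ x ∈ X, ¬ (openGraph ω).Reachable s x} ∩ {ω | ∀ x ∈ X, ¬ (openGraph ω).Reachable y x}) *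
      (prodBernoulli w).real ({ω : BondConfig V | ∀ x ∈ X, ¬ (openGraph ω).Reachable s x} ∩ {ω | ∀ x ∈ X, ¬ (openGraph ω).Reachable y x}ᶜ) *
      ((prodBernoulli w).real ({ω : BondConfig V | ∀ x ∈ insert s X, ¬ (openGraph ω).Reachable y x} ∩
            {ω | ∀ x ∈ X, ¬ (openGraph ω).Reachable s x}) *
          ((prodBernoulli w).real {ω : BondConfig V | ∀ x ∈ X, ¬ (openGraph ω).Reachable s x} *
              (∫ ω in {ω : BondConfig V | ∀ x ∈ X, ¬ (openGraph ω).Reachable s x} ∩ openConn s z,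
                F (openEdgeCluster ω s) ∂(prodBernoulli w)) -
            (∫ ω in {ω : BondConfig V | ∀ x ∈ X, ¬ (openGraph ω).Reachable s x}, F (openEdgeCluster ω s) ∂(prodBernoulli w)) *
              (prodBernoulli w).real ({ω : BondConfig V | ∀ x ∈ X, ¬ (openGraph ω).Reachable s x} ∩ openConn s z)) -
        (prodBernoulli w).real ({ω : BondConfig V | ∀ x ∈ insert s X, ¬ (openGraph ω).Reachable y x} ∩
            {ω | ∀ x ∈ X, ¬ (openGraph ω).Reachable s x} ∩ openConn y z) *
          ((prodBernoulli w).real {ω : BondConfig V | ∀ x ∈ X, ¬ (openGraph ω).Reachable s x} *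
              (∫ ω in {ω : BondConfig V | ∀ x ∈ X, ¬ (openGraph ω).Reachable s x} ∩ openConn s y,
                F (openEdgeCluster ω s) ∂(prodBernoulli w)) -
            (∫ ω in {ω : BondConfig V | ∀ x ∈ X, ¬ (openGraph ω).Reachable s x}, F (openEdgeCluster ω s) ∂(prodBernoulli w)) *
              (prodBernoulli w).real ({ω : BondConfig V | ∀ x ∈ X, ¬ (openGraph ω).Reachable s x} ∩ openConn s y))) =
    (prodBernoulli w).real {ω : BondConfig V | ∀ x ∈ X, ¬ (openGraph ω).Reachable s x} *
      (prodBernoulli w).real ({ω : BondConfig V | ∀ x ∈ X, ¬ (openGraph ω).Reachable s x} ∩ {ω | ∀ x ∈ X, ¬ (openGraph ω).Reachable y x}ᶜ) *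
      ((prodBernoulli w).real ({ω : BondConfig V | ∀ x ∈ insert s X, ¬ (openGraph ω).Reachable y x} ∩
            {ω | ∀ x ∈ X, ¬ (openGraph ω).Reachable s x}) *
          ((prodBernoulli w).real ({ω : BondConfig V | ∀ x ∈ X, ¬ (openGraph ω).Reachable s x} ∩ {ω | ∀ x ∈ X, ¬ (openGraph ω).Reachable y x}) *
              (∫ ω in {ω : BondConfig V | ∀ x ∈ X, ¬ (openGraph ω).Reachable s x} ∩ {ω | ∀ x ∈ X, ¬ (openGraph ω).Reachable y x} ∩ openConn s z,
                F (openEdgeCluster ω s) ∂(prodBernoulli w)) -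
            (∫ ω in {ω : BondConfig V | ∀ x ∈ X, ¬ (openGraph ω).Reachable s x} ∩ {ω | ∀ x ∈ X, ¬ (openGraph ω).Reachable y x},
                F (openEdgeCluster ω s) ∂(prodBernoulli w)) *
              (prodBernoulli w).real ({ω : BondConfig V | ∀ x ∈ X, ¬ (openGraph ω).Reachable s x} ∩ {ω | ∀ x ∈ X, ¬ (openGraph ω).Reachable y x} ∩
                openConn s z)) -
        (prodBernoulli w).real ({ω : BondConfig V | ∀ x ∈ insert s X, ¬ (openGraph ω).Reachable y x} ∩
            {ω | ∀ x ∈ X, ¬ (openGraph ω).Reachable s x} ∩ openConn y z) *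
          ((prodBernoulli w).real ({ω : BondConfig V | ∀ x ∈ X, ¬ (openGraph ω).Reachable s x} ∩ {ω | ∀ x ∈ X, ¬ (openGraph ω).Reachable y x}) *
              (∫ ω in {ω : BondConfig V | ∀ x ∈ X, ¬ (openGraph ω).Reachable s x} ∩ {ω | ∀ x ∈ X, ¬ (openGraph ω).Reachable y x} ∩ openConn s y,
                F (openEdgeCluster ω s) ∂(prodBernoulli w)) -
            (∫ ω in {ω : BondConfig V | ∀ x ∈ X, ¬ (openGraph ω).Reachable s x} ∩ {ω | ∀ x ∈ X, ¬ (openGraph ω).Reachable y x},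
                F (openEdgeCluster ω s) ∂(prodBernoulli w)) *
              (prodBernoulli w).real ({ω : BondConfig V | ∀ x ∈ X, ¬ (openGraph ω).Reachable s x} ∩ {ω | ∀ x ∈ X, ¬ (openGraph ω).Reachable y x} ∩
                openConn s y))) +
      (prodBernoulli w).real ({ω : BondConfig V | ∀ x ∈ insert s X, ¬ (openGraph ω).Reachable y x} ∩
            {ω | ∀ x ∈ X, ¬ (openGraph ω).Reachable s x}) *
          (prodBernoulli w).real {ω : BondConfig V | ∀ x ∈ X, ¬ (openGraph ω).Reachable s x} *
          (prodBernoulli w).real ({ω : BondConfig V | ∀ x ∈ X, ¬ (openGraph ω).Reachable s x} ∩ {ω | ∀ x ∈ X, ¬ (openGraph ω).Reachable y x}) *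
        ((prodBernoulli w).real ({ω : BondConfig V | ∀ x ∈ X, ¬ (openGraph ω).Reachable s x} ∩ {ω | ∀ x ∈ X, ¬ (openGraph ω).Reachable y x}ᶜ) *
            (∫ ω in {ω : BondConfig V | ∀ x ∈ X, ¬ (openGraph ω).Reachable s x} ∩ {ω | ∀ x ∈ X, ¬ (openGraph ω).Reachable y x}ᶜ ∩ openConn s z,
              F (openEdgeCluster ω s) ∂(prodBernoulli w)) -
          (∫ ω in {ω : BondConfig V | ∀ x ∈ X, ¬ (openGraph ω).Reachable s x} ∩ {ω | ∀ x ∈ X, ¬ (openGraph ω).Reachable y x}ᶜ,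
              F (openEdgeCluster ω s) ∂(prodBernoulli w)) *
            (prodBernoulli w).real ({ω : BondConfig V | ∀ x ∈ X, ¬ (openGraph ω).Reachable s x} ∩ {ω | ∀ x ∈ X, ¬ (openGraph ω).Reachable y x}ᶜ ∩
              openConn s z)) +
      ((prodBernoulli w).real ({ω : BondConfig V | ∀ x ∈ insert s X, ¬ (openGraph ω).Reachable y x} ∩
              {ω | ∀ x ∈ X, ¬ (openGraph ω).Reachable s x}) *
            (prodBernoulli w).real ({ω : BondConfig V | ∀ x ∈ X, ¬ (openGraph ω).Reachable s x} ∩ {ω | ∀ x ∈ X, ¬ (openGraph ω).Reachable y x} ∩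
              openConn s z) *
            (prodBernoulli w).real ({ω : BondConfig V | ∀ x ∈ X, ¬ (openGraph ω).Reachable s x} ∩ {ω | ∀ x ∈ X, ¬ (openGraph ω).Reachable y x}ᶜ) -
          (prodBernoulli w).real ({ω : BondConfig V | ∀ x ∈ insert s X, ¬ (openGraph ω).Reachable y x} ∩
              {ω | ∀ x ∈ X, ¬ (openGraph ω).Reachable s x}) *
            (prodBernoulli w).real ({ω : BondConfig V | ∀ x ∈ X, ¬ (openGraph ω).Reachable s x} ∩ {ω | ∀ x ∈ X, ¬ (openGraph ω).Reachable y x}ᶜ ∩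
              openConn s z) *
            (prodBernoulli w).real ({ω : BondConfig V | ∀ x ∈ X, ¬ (openGraph ω).Reachable s x} ∩ {ω | ∀ x ∈ X, ¬ (openGraph ω).Reachable y x}) -
          (prodBernoulli w).real ({ω : BondConfig V | ∀ x ∈ insert s X, ¬ (openGraph ω).Reachable y x} ∩
              {ω | ∀ x ∈ X, ¬ (openGraph ω).Reachable s x} ∩ openConn y z) *
            (prodBernoulli w).real ({ω : BondConfig V | ∀ x ∈ X, ¬ (openGraph ω).Reachable s x} ∩ openConn s y) *
            (prodBernoulli w).real ({ω : BondConfig V | ∀ x ∈ X, ¬ (openGraph ω).Reachable s x} ∩ {ω | ∀ x ∈ X, ¬ (openGraph ω).Reachable y x}ᶜ)) *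
        ((∫ ω in {ω : BondConfig V | ∀ x ∈ X, ¬ (openGraph ω).Reachable s x} ∩ {ω | ∀ x ∈ X, ¬ (openGraph ω).Reachable y x},
              F (openEdgeCluster ω s) ∂(prodBernoulli w)) *
            (prodBernoulli w).real ({ω : BondConfig V | ∀ x ∈ X, ¬ (openGraph ω).Reachable s x} ∩ {ω | ∀ x ∈ X, ¬ (openGraph ω).Reachable y x}ᶜ) -
          (∫ ω in {ω : BondConfig V | ∀ x ∈ X, ¬ (openGraph ω).Reachable s x} ∩ {ω | ∀ x ∈ X, ¬ (openGraph ω).Reachable y x}ᶜ,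
              F (openEdgeCluster ω s) ∂(prodBernoulli w)) *
            (prodBernoulli w).real ({ω : BondConfig V | ∀ x ∈ X, ¬ (openGraph ω).Reachable s x} ∩ {ω | ∀ x ∈ X, ¬ (openGraph ω).Reachable y x})) := by
  classical
  set μ := prodBernoulli w with hμ
  have hmeas : ∀ S : Set (BondConfig V), MeasurableSet S := fun _ => MeasurableSet.of_discrete
  set D : Set (BondConfig V) := {ω | ∀ x ∈ X, ¬ (openGraph ω).Reachable s x} with hD
  set Av : Set (BondConfig V) := {ω | ∀ x ∈ X, ¬ (openGraph ω).Reachable y x} with hAv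
  set T : Set (BondConfig V) := {ω : BondConfig V | ∀ x ∈ insert s X, ¬ (openGraph ω).Reachable y x} ∩ D with hT
  set TW : Set (BondConfig V) := {ω : BondConfig V | ∀ x ∈ insert s X, ¬ (openGraph ω).Reachable y x} ∩ D ∩ openConn y z with hTW
  set Yv : Set (BondConfig V) := openConn s y with hYv
  set Zv : Set (BondConfig V) := openConn s z with hZv
  set f : BondConfig V → ℝ := fun ω => F (openEdgeCluster ω s) with hf
  -- the pieces
  set e := μ.real (D ∩ Av) with he
  set q := μ.real (D ∩ Avᶜ) with hq
  set fE := ∫ ω in D ∩ Av, f ω ∂μ with hfE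
  set fQ := ∫ ω in D ∩ Avᶜ, f ω ∂μ with hfQ
  set zE := μ.real (D ∩ Av ∩ Zv) with hzE
  set zQ := μ.real (D ∩ Avᶜ ∩ Zv) with hzQ
  set fzE := ∫ ω in D ∩ Av ∩ Zv, f ω ∂μ with hfzE
  set fzQ := ∫ ω in D ∩ Avᶜ ∩ Zv, f ω ∂μ with hfzQ
  set mY := μ.real (D ∩ Yv) with hmY
  set fY := ∫ ω in D ∩ Yv, f ω ∂μ with hfY
  -- decompositions along `Av`
  have hd : μ.real D = e + q := by
    have h := measureReal_inter_add_sdiff (μ := μ) (s := D) (hmeas Av)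
    rw [Set.sdiff_eq] at h; exact h.symm
  have hfD : ∫ ω in D, f ω ∂μ = fE + fQ := (setIntegral_inter_add_compl w D Av f).symm
  have hzD : μ.real (D ∩ Zv) = zE + zQ := by
    have h := measureReal_inter_add_sdiff (μ := μ) (s := D ∩ Zv) (hmeas Av)
    rw [Set.sdiff_eq, inter_right_comm D Zv Av, inter_right_comm D Zv Avᶜ] at h; exact h.symm
  have hfzD : ∫ ω in D ∩ Zv, f ω ∂μ = fzE + fzQ := by
    have h := setIntegral_inter_add_compl w (D ∩ Zv) Av f
    rw [inter_right_comm D Zv Av, inter_right_comm D Zv Avᶜ] at h; exact h.symm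
  -- the `Y`-quantities live in `E₁`
  have hYE : D ∩ Av ∩ Yv = D ∩ Yv := by
    ext ω
    simp only [mem_inter_iff]
    constructor
    · rintro ⟨⟨hD', _⟩, hY⟩; exact ⟨hD', hY⟩
    · rintro ⟨hD', hY⟩; exact ⟨⟨hD', inter_openConn_subset_avoid s y X ⟨hD', hY⟩⟩, hY⟩
  rw [show μ.real (D ∩ Av ∩ Yv) = mY by rw [hYE], show ∫ ω in D ∩ Av ∩ Yv, f ω ∂μ = fY by rw [hYE], hd, hfD, hzD, hfzD]
  exact mdlx_avoidSplit_algebra (μ.real T) (μ.real TW) e q fE fQ zE zQ fzE fzQ mY fY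

/-- **`H ≥ 0`: the marker-avoidance transfer.**  For monotone `F`: `(∫_{D_Q} F)·μ(E₁) ≤ (∫_{E₁} F)·μ(D_Q)`, i.e. under `ν = μ(·|s↮X)`,
`E_ν[F(C_s) | y ↮ X] ≥ E_ν[F(C_s) | y ↔ X]` — `F(C_s)` (increasing in `C_s`) and `1{y ∉ V(C_X)}` (decreasing in `C_X`) are positively
correlated given `{s ↮ X}`: van den Berg–Häggström–Kahn's Theorem 2.1 with sets (`BHK2006_twoSetConditionalAssociation`).
[cite: VandenbergHaggstromKahn2005, Thm. 2.1 (p. 9) at q = 1; Remark 1 after Thm. 1.2 (p. 5)] -/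
theorem avoidSplit_transfer_nonneg (w : Sym2 V → unitInterval) (s y : V) (X : Set V) (F : Set (Sym2 V) → ℝ) (hF : Monotone F) :
    (∫ ω in {ω : BondConfig V | ∀ x ∈ X, ¬ (openGraph ω).Reachable s x} ∩ {ω | ∀ x ∈ X, ¬ (openGraph ω).Reachable y x}ᶜ,
        F (openEdgeCluster ω s) ∂(prodBernoulli w)) *
      (prodBernoulli w).real ({ω : BondConfig V | ∀ x ∈ X, ¬ (openGraph ω).Reachable s x} ∩ {ω | ∀ x ∈ X, ¬ (openGraph ω).Reachable y x}) ≤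
    (∫ ω in {ω : BondConfig V | ∀ x ∈ X, ¬ (openGraph ω).Reachable s x} ∩ {ω | ∀ x ∈ X, ¬ (openGraph ω).Reachable y x},
        F (openEdgeCluster ω s) ∂(prodBernoulli w)) *
      (prodBernoulli w).real ({ω : BondConfig V | ∀ x ∈ X, ¬ (openGraph ω).Reachable s x} ∩ {ω | ∀ x ∈ X, ¬ (openGraph ω).Reachable y x}ᶜ) := by
  classical
  set μ := prodBernoulli w with hμ
  have hmeas : ∀ S : Set (BondConfig V), MeasurableSet S := fun _ => MeasurableSet.of_discrete
  set D : Set (BondConfig V) := {ω | ∀ x ∈ X, ¬ (openGraph ω).Reachable s x} with hD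
  set Av : Set (BondConfig V) := {ω | ∀ x ∈ X, ¬ (openGraph ω).Reachable y x} with hAv
  set f : BondConfig V → ℝ := fun ω => F (openEdgeCluster ω s) with hf
  -- the antitone `C_X`-functional `1{y ∉ X, no edge of C_X contains y}`
  set G : Set (Sym2 V) → Set (Sym2 V) → ℝ := fun _ L => if (y ∉ X ∧ ∀ e ∈ L, y ∉ e) then 1 else 0 with hG
  have hG₂ : ∀ C, Antitone fun L => G C L := by
    intro C L L' hLL'
    simp only [hG]
    by_cases h' : (y ∉ X ∧ ∀ e ∈ L', y ∉ e)
    · rw [if_pos h', if_pos ⟨h'.1, fun e he => h'.2 e (hLL' he)⟩]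
    · rw [if_neg h']; split_ifs <;> norm_num
  have key := BHK2006_twoSetConditionalAssociation w {s} X (fun C _ => F C) G
    (fun _ => hF) (fun _ => antitone_const) (fun _ => monotone_const) hG₂
  -- read the events
  have hDS : {ω : BondConfig V | ∀ s' ∈ ({s} : Set V), ∀ t ∈ X, ¬ (openGraph ω).Reachable s' t} = D := by
    ext ω; simp [hD]
  have hCS : ∀ ω : BondConfig V, (⋃ s' ∈ ({s} : Set V), openEdgeCluster ω s') = openEdgeCluster ω s := by
    intro ω; ext e; simp
  have hGA : ∀ ω : BondConfig V, G (openEdgeCluster ω s) (⋃ t ∈ X, openEdgeCluster ω t) = Av.indicator 1 ω := by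
    intro ω
    have hiff : (y ∉ X ∧ ∀ e ∈ (⋃ t ∈ X, openEdgeCluster ω t), y ∉ e) ↔ ω ∈ Av := by
      simp only [hAv, mem_setOf_eq, mem_iUnion, exists_prop]
      constructor
      · rintro ⟨hyX, hno⟩ x hx hr
        rcases (reachable_iff_exists_mem_openEdgeCluster ω x y).1 hr.symm with h | ⟨e, he, hye⟩
        · exact hyX (h ▸ hx)
        · exact hno e ⟨x, hx, he⟩ hye
      · intro hA
        refine ⟨fun hyX => hA y hyX (SimpleGraph.Reachable.refl y), ?_⟩
        rintro e ⟨x, hx, he⟩ hye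
        exact hA x hx ((reachable_iff_exists_mem_openEdgeCluster ω x y).2 (Or.inr ⟨e, he, hye⟩)).symm
    by_cases hω : ω ∈ Av
    · rw [hG]; simp only; rw [if_pos (hiff.2 hω), indicator_of_mem hω, Pi.one_apply]
    · rw [hG]; simp only; rw [if_neg (fun h => hω (hiff.1 h)), indicator_of_notMem hω]
  simp only [hDS, hCS, hGA] at key
  rw [KNPreFKG.setIntegral_indicator_one_eq μ, setIntegral_mul_indicator_one μ] at key
  -- key : (∫_D f) * μ(D ∩ Av) ≤ μ(D) * ∫_{D∩Av} f
  have hd : μ.real D = μ.real (D ∩ Av) + μ.real (D ∩ Avᶜ) := by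
    have h := measureReal_inter_add_sdiff (μ := μ) (s := D) (hmeas Av)
    rw [Set.sdiff_eq] at h; exact h.symm
  have hfD : ∫ ω in D, f ω ∂μ = (∫ ω in D ∩ Av, f ω ∂μ) + ∫ ω in D ∩ Avᶜ, f ω ∂μ := (setIntegral_inter_add_compl w D Av f).symm
  change (∫ ω in D ∩ Avᶜ, f ω ∂μ) * μ.real (D ∩ Av) ≤ (∫ ω in D ∩ Av, f ω ∂μ) * μ.real (D ∩ Avᶜ)
  change (∫ ω in D, f ω ∂μ) * μ.real (D ∩ Av) ≤ μ.real D * ∫ ω in D ∩ Av, f ω ∂μ at key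
  rw [hd, hfD] at key
  nlinarith [key]


/-- **THE REDUCTION `MDLXJoint ⟸ (E₁-form) ∧ (Q-world form)`, instance by instance.**  If the MDL(X)″ margin
`M₁ = μ(T)·cov_{E₁}(F;Z) − μ(T∩W)·cov_{E₁}(F;Y)` is `≥ 0` and the `Q`-world expression `μ(T)μ(D)μ(E₁)·cov_{D_Q}(F;Z) + G·H` is `≥ 0`
(letters of the module docstring), then the `Consts.MDLXJoint` inequality holds at `(w, s, y, z, X, F)` — by `Consts.mdlx_avoidSplit_identity`
(degenerate cases `μ(E₁) = 0`, `μ(D_Q) = 0` directly). [cite: VandenbergHaggstromKahn2005, §2.1 (pp. 9–13)] -/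
theorem mdlxJoint_of_avoidSplit (w : Sym2 V → unitInterval) (s y z : V) (X : Set V) (F : Set (Sym2 V) → ℝ)
    (h1 : 0 ≤ (prodBernoulli w).real ({ω : BondConfig V | ∀ x ∈ insert s X, ¬ (openGraph ω).Reachable y x} ∩
            {ω | ∀ x ∈ X, ¬ (openGraph ω).Reachable s x}) *
          ((prodBernoulli w).real ({ω : BondConfig V | ∀ x ∈ X, ¬ (openGraph ω).Reachable s x} ∩ {ω | ∀ x ∈ X, ¬ (openGraph ω).Reachable y x}) *
              (∫ ω in {ω : BondConfig V | ∀ x ∈ X, ¬ (openGraph ω).Reachable s x} ∩ {ω | ∀ x ∈ X, ¬ (openGraph ω).Reachable y x} ∩ openConn s z,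
                F (openEdgeCluster ω s) ∂(prodBernoulli w)) -
            (∫ ω in {ω : BondConfig V | ∀ x ∈ X, ¬ (openGraph ω).Reachable s x} ∩ {ω | ∀ x ∈ X, ¬ (openGraph ω).Reachable y x},
                F (openEdgeCluster ω s) ∂(prodBernoulli w)) *
              (prodBernoulli w).real ({ω : BondConfig V | ∀ x ∈ X, ¬ (openGraph ω).Reachable s x} ∩ {ω | ∀ x ∈ X, ¬ (openGraph ω).Reachable y x} ∩
                openConn s z)) -
        (prodBernoulli w).real ({ω : BondConfig V | ∀ x ∈ insert s X, ¬ (openGraph ω).Reachable y x} ∩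
            {ω | ∀ x ∈ X, ¬ (openGraph ω).Reachable s x} ∩ openConn y z) *
          ((prodBernoulli w).real ({ω : BondConfig V | ∀ x ∈ X, ¬ (openGraph ω).Reachable s x} ∩ {ω | ∀ x ∈ X, ¬ (openGraph ω).Reachable y x}) *
              (∫ ω in {ω : BondConfig V | ∀ x ∈ X, ¬ (openGraph ω).Reachable s x} ∩ {ω | ∀ x ∈ X, ¬ (openGraph ω).Reachable y x} ∩ openConn s y,
                F (openEdgeCluster ω s) ∂(prodBernoulli w)) -
            (∫ ω in {ω : BondConfig V | ∀ x ∈ X, ¬ (openGraph ω).Reachable s x} ∩ {ω | ∀ x ∈ X, ¬ (openGraph ω).Reachable y x},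
                F (openEdgeCluster ω s) ∂(prodBernoulli w)) *
              (prodBernoulli w).real ({ω : BondConfig V | ∀ x ∈ X, ¬ (openGraph ω).Reachable s x} ∩ {ω | ∀ x ∈ X, ¬ (openGraph ω).Reachable y x} ∩
                openConn s y)))
    (h3 : 0 ≤ (prodBernoulli w).real ({ω : BondConfig V | ∀ x ∈ insert s X, ¬ (openGraph ω).Reachable y x} ∩
            {ω | ∀ x ∈ X, ¬ (openGraph ω).Reachable s x}) *
          (prodBernoulli w).real {ω : BondConfig V | ∀ x ∈ X, ¬ (openGraph ω).Reachable s x} *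
          (prodBernoulli w).real ({ω : BondConfig V | ∀ x ∈ X, ¬ (openGraph ω).Reachable s x} ∩ {ω | ∀ x ∈ X, ¬ (openGraph ω).Reachable y x}) *
        ((prodBernoulli w).real ({ω : BondConfig V | ∀ x ∈ X, ¬ (openGraph ω).Reachable s x} ∩ {ω | ∀ x ∈ X, ¬ (openGraph ω).Reachable y x}ᶜ) *
            (∫ ω in {ω : BondConfig V | ∀ x ∈ X, ¬ (openGraph ω).Reachable s x} ∩ {ω | ∀ x ∈ X, ¬ (openGraph ω).Reachable y x}ᶜ ∩ openConn s z,
              F (openEdgeCluster ω s) ∂(prodBernoulli w)) -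
          (∫ ω in {ω : BondConfig V | ∀ x ∈ X, ¬ (openGraph ω).Reachable s x} ∩ {ω | ∀ x ∈ X, ¬ (openGraph ω).Reachable y x}ᶜ,
              F (openEdgeCluster ω s) ∂(prodBernoulli w)) *
            (prodBernoulli w).real ({ω : BondConfig V | ∀ x ∈ X, ¬ (openGraph ω).Reachable s x} ∩ {ω | ∀ x ∈ X, ¬ (openGraph ω).Reachable y x}ᶜ ∩
              openConn s z)) +
      ((prodBernoulli w).real ({ω : BondConfig V | ∀ x ∈ insert s X, ¬ (openGraph ω).Reachable y x} ∩
              {ω | ∀ x ∈ X, ¬ (openGraph ω).Reachable s x}) *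
            (prodBernoulli w).real ({ω : BondConfig V | ∀ x ∈ X, ¬ (openGraph ω).Reachable s x} ∩ {ω | ∀ x ∈ X, ¬ (openGraph ω).Reachable y x} ∩
              openConn s z) *
            (prodBernoulli w).real ({ω : BondConfig V | ∀ x ∈ X, ¬ (openGraph ω).Reachable s x} ∩ {ω | ∀ x ∈ X, ¬ (openGraph ω).Reachable y x}ᶜ) -
          (prodBernoulli w).real ({ω : BondConfig V | ∀ x ∈ insert s X, ¬ (openGraph ω).Reachable y x} ∩
              {ω | ∀ x ∈ X, ¬ (openGraph ω).Reachable s x}) *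
            (prodBernoulli w).real ({ω : BondConfig V | ∀ x ∈ X, ¬ (openGraph ω).Reachable s x} ∩ {ω | ∀ x ∈ X, ¬ (openGraph ω).Reachable y x}ᶜ ∩
              openConn s z) *
            (prodBernoulli w).real ({ω : BondConfig V | ∀ x ∈ X, ¬ (openGraph ω).Reachable s x} ∩ {ω | ∀ x ∈ X, ¬ (openGraph ω).Reachable y x}) -
          (prodBernoulli w).real ({ω : BondConfig V | ∀ x ∈ insert s X, ¬ (openGraph ω).Reachable y x} ∩
              {ω | ∀ x ∈ X, ¬ (openGraph ω).Reachable s x} ∩ openConn y z) *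
            (prodBernoulli w).real ({ω : BondConfig V | ∀ x ∈ X, ¬ (openGraph ω).Reachable s x} ∩ openConn s y) *
            (prodBernoulli w).real ({ω : BondConfig V | ∀ x ∈ X, ¬ (openGraph ω).Reachable s x} ∩ {ω | ∀ x ∈ X, ¬ (openGraph ω).Reachable y x}ᶜ)) *
        ((∫ ω in {ω : BondConfig V | ∀ x ∈ X, ¬ (openGraph ω).Reachable s x} ∩ {ω | ∀ x ∈ X, ¬ (openGraph ω).Reachable y x},
              F (openEdgeCluster ω s) ∂(prodBernoulli w)) *
            (prodBernoulli w).real ({ω : BondConfig V | ∀ x ∈ X, ¬ (openGraph ω).Reachable s x} ∩ {ω | ∀ x ∈ X, ¬ (openGraph ω).Reachable y x}ᶜ) -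
          (∫ ω in {ω : BondConfig V | ∀ x ∈ X, ¬ (openGraph ω).Reachable s x} ∩ {ω | ∀ x ∈ X, ¬ (openGraph ω).Reachable y x}ᶜ,
              F (openEdgeCluster ω s) ∂(prodBernoulli w)) *
            (prodBernoulli w).real ({ω : BondConfig V | ∀ x ∈ X, ¬ (openGraph ω).Reachable s x} ∩ {ω | ∀ x ∈ X, ¬ (openGraph ω).Reachable y x}))) :
    (prodBernoulli w).real ({ω : BondConfig V | ∀ x ∈ insert s X, ¬ (openGraph ω).Reachable y x} ∩
          {ω | ∀ x ∈ X, ¬ (openGraph ω).Reachable s x} ∩ openConn y z) *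
        ((prodBernoulli w).real {ω : BondConfig V | ∀ x ∈ X, ¬ (openGraph ω).Reachable s x} *
            (∫ ω in {ω : BondConfig V | ∀ x ∈ X, ¬ (openGraph ω).Reachable s x} ∩ openConn s y,
              F (openEdgeCluster ω s) ∂(prodBernoulli w)) -
          (∫ ω in {ω : BondConfig V | ∀ x ∈ X, ¬ (openGraph ω).Reachable s x},
              F (openEdgeCluster ω s) ∂(prodBernoulli w)) *
            (prodBernoulli w).real ({ω : BondConfig V | ∀ x ∈ X, ¬ (openGraph ω).Reachable s x} ∩ openConn s y)) ≤
      (prodBernoulli w).real ({ω : BondConfig V | ∀ x ∈ insert s X, ¬ (openGraph ω).Reachable y x} ∩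
          {ω | ∀ x ∈ X, ¬ (openGraph ω).Reachable s x}) *
        ((prodBernoulli w).real {ω : BondConfig V | ∀ x ∈ X, ¬ (openGraph ω).Reachable s x} *
            (∫ ω in {ω : BondConfig V | ∀ x ∈ X, ¬ (openGraph ω).Reachable s x} ∩ openConn s z,
              F (openEdgeCluster ω s) ∂(prodBernoulli w)) -
          (∫ ω in {ω : BondConfig V | ∀ x ∈ X, ¬ (openGraph ω).Reachable s x},
              F (openEdgeCluster ω s) ∂(prodBernoulli w)) *
            (prodBernoulli w).real ({ω : BondConfig V | ∀ x ∈ X, ¬ (openGraph ω).Reachable s x} ∩ openConn s z)) := by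
  classical
  have ident := mdlx_avoidSplit_identity w s y z X F
  set μ := prodBernoulli w with hμ
  have hmeas : ∀ S : Set (BondConfig V), MeasurableSet S := fun _ => MeasurableSet.of_discrete
  set D : Set (BondConfig V) := {ω | ∀ x ∈ X, ¬ (openGraph ω).Reachable s x} with hD
  set Av : Set (BondConfig V) := {ω | ∀ x ∈ X, ¬ (openGraph ω).Reachable y x} with hAv
  set T : Set (BondConfig V) := {ω : BondConfig V | ∀ x ∈ insert s X, ¬ (openGraph ω).Reachable y x} ∩ D with hT
  set TW : Set (BondConfig V) := {ω : BondConfig V | ∀ x ∈ insert s X, ¬ (openGraph ω).Reachable y x} ∩ D ∩ openConn y z with hTW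
  set Yv : Set (BondConfig V) := openConn s y with hYv
  set Zv : Set (BondConfig V) := openConn s z with hZv
  set f : BondConfig V → ℝ := fun ω => F (openEdgeCluster ω s) with hf
  set e := μ.real (D ∩ Av) with he
  set q := μ.real (D ∩ Avᶜ) with hq
  set fE := ∫ ω in D ∩ Av, f ω ∂μ with hfE
  set fQ := ∫ ω in D ∩ Avᶜ, f ω ∂μ with hfQ
  set zE := μ.real (D ∩ Av ∩ Zv) with hzE
  set zQ := μ.real (D ∩ Avᶜ ∩ Zv) with hzQ
  set fzE := ∫ ω in D ∩ Av ∩ Zv, f ω ∂μ with hfzE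
  set fzQ := ∫ ω in D ∩ Avᶜ ∩ Zv, f ω ∂μ with hfzQ
  set mY := μ.real (D ∩ Yv) with hmY
  set fY := ∫ ω in D ∩ Yv, f ω ∂μ with hfY
  set yE := μ.real (D ∩ Av ∩ Yv) with hyE
  set fyE := ∫ ω in D ∩ Av ∩ Yv, f ω ∂μ with hfyE
  set t := μ.real T with ht
  set tw := μ.real TW with htw
  set M := t * (μ.real D * (∫ ω in D ∩ Zv, f ω ∂μ) - (∫ ω in D, f ω ∂μ) * μ.real (D ∩ Zv)) -
      tw * (μ.real D * fY - (∫ ω in D, f ω ∂μ) * mY) with hM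
  set M₁ := t * (e * fzE - fE * zE) - tw * (e * fyE - fE * yE) with hM₁
  set M₃ := t * μ.real D * e * (q * fzQ - fQ * zQ) + (t * zE * q - t * zQ * e - tw * mY * q) * (fE * q - fQ * e) with hM₃
  have ident' : e * q * M = μ.real D * q * M₁ + M₃ := by linarith [ident, hM₃]
  change 0 ≤ M₁ at h1
  change 0 ≤ M₃ at h3
  -- goal: LHS ≤ RHS, i.e. 0 ≤ M
  suffices hM0 : 0 ≤ M by
    change tw * (μ.real D * fY - (∫ ω in D, f ω ∂μ) * mY) ≤
      t * (μ.real D * (∫ ω in D ∩ Zv, f ω ∂μ) - (∫ ω in D, f ω ∂μ) * μ.real (D ∩ Zv))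
    linarith [hM0]
  have he0 : 0 ≤ e := measureReal_nonneg
  have hq0 : 0 ≤ q := measureReal_nonneg
  have hd0 : 0 ≤ μ.real D := measureReal_nonneg
  by_cases hez : e = 0
  · -- `μ(E₁) = 0`: `T, T∩W ⊆ E₁` are null, `M = 0`
    have hTsub : T ⊆ D ∩ Av := fun ω hω => ⟨hω.2, fun x hx => hω.1 x (mem_insert_of_mem s hx)⟩
    have ht0 : t = 0 := le_antisymm (hez ▸ measureReal_mono hTsub) measureReal_nonneg
    have htw0 : tw = 0 := le_antisymm (ht0 ▸ measureReal_mono (inter_subset_left : TW ⊆ T)) measureReal_nonneg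
    rw [hM, ht0, htw0]; simp
  by_cases hqz : q = 0
  · -- `μ(D_Q) = 0`: the `D`-quantities are the `E₁`-quantities and `M = M₁`
    have hμq : μ (D ∩ Avᶜ) = 0 := (measureReal_eq_zero_iff (measure_ne_top μ _)).1 hqz
    have hfQ0 : fQ = 0 := setIntegral_measure_zero _ hμq
    have hμqz : μ (D ∩ Avᶜ ∩ Zv) = 0 := measure_mono_null inter_subset_left hμq
    have hzQ0 : zQ = 0 := by
      show μ.real (D ∩ Avᶜ ∩ Zv) = 0
      rw [measureReal_def, hμqz, ENNReal.toReal_zero]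
    have hfzQ0 : fzQ = 0 := setIntegral_measure_zero _ hμqz
    have hd : μ.real D = e + q := by
      have h := measureReal_inter_add_sdiff (μ := μ) (s := D) (hmeas Av)
      rw [Set.sdiff_eq] at h; exact h.symm
    have hfD : ∫ ω in D, f ω ∂μ = fE + fQ := (setIntegral_inter_add_compl w D Av f).symm
    have hzD : μ.real (D ∩ Zv) = zE + zQ := by
      have h := measureReal_inter_add_sdiff (μ := μ) (s := D ∩ Zv) (hmeas Av)
      rw [Set.sdiff_eq, inter_right_comm D Zv Av, inter_right_comm D Zv Avᶜ] at h; exact h.symm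
    have hfzD : ∫ ω in D ∩ Zv, f ω ∂μ = fzE + fzQ := by
      have h := setIntegral_inter_add_compl w (D ∩ Zv) Av f
      rw [inter_right_comm D Zv Av, inter_right_comm D Zv Avᶜ] at h; exact h.symm
    have hYE : D ∩ Av ∩ Yv = D ∩ Yv := by
      ext ω
      simp only [mem_inter_iff]
      constructor
      · rintro ⟨⟨hD', _⟩, hY⟩; exact ⟨hD', hY⟩
      · rintro ⟨hD', hY⟩; exact ⟨⟨hD', inter_openConn_subset_avoid s y X ⟨hD', hY⟩⟩, hY⟩
    have hyE' : yE = mY := by rw [hyE, hYE]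
    have hfyE' : fyE = fY := by rw [hfyE, hYE]
    have hMM : M = M₁ := by
      rw [hM, hM₁, hd, hfD, hzD, hfzD, hfQ0, hzQ0, hfzQ0, hqz, hyE', hfyE']; ring
    rw [hMM]; exact h1
  have hpos : 0 < e * q := mul_pos (lt_of_le_of_ne he0 (Ne.symm hez)) (lt_of_le_of_ne hq0 (Ne.symm hqz))
  have hrhs : 0 ≤ μ.real D * q * M₁ + M₃ := add_nonneg (mul_nonneg (mul_nonneg hd0 hq0) h1) h3
  by_contra hneg
  have hlt : M < 0 := lt_of_not_ge hneg
  have := mul_neg_of_pos_of_neg hpos hlt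
  linarith [ident']

end Consts

end Summit.CriticalPhenomena.PercolationContinuityZ3.Theorems

end
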